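import Literature.NumberTheory.GelbartRogawski1991.CompatibleSplittingCMDoubling
import Literature.NumberTheory.GelbartRogawski1991.DoubledWeilRepresentationLocalFamilyCM
import Literature.NumberTheory.GelbartRogawski1991.DoubledWeilRepresentationArchHalf
import HarnessLib

/-!
# [GelbartRogawski1991, Prop. 3.1.1] for the CM dual-pair datum — the compatible splitting, unconditionally

Gelbart–Rogawski, Invent. Math. 105 (1991), §3.1 Prop. 3.1.1 p. 455 L1–2: *"The covering `π` splits over `G(𝐀)`.
There exists a continuous section `s : G(𝐀) → Mp_𝐀(W)` such that `s(G(F))` is contained in `i(Sp_F(W))`."*  For the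
tree's CM dual-pair datum `cmSplittingDatum L e dV hdV hdV0 dW hdW hdW0` (`UnitaryDualPairThetaKernelCM`: `G = U(𝕍)`,
`𝕍 = V ⊗_L W` with diagonal hermitian Gram matrices `diag dV ⊗ diag dW` over a CM field `L`, inside
`Sp(Res_{L/L⁺} 𝕍)(𝔸)`, `Mp := adelicMpCont`, `i := r_F` Weil's Θ-rigid rational section) this file PROVES
`SplittingDatum.CompatibleSplitting` with NO hypothesis, by composing the doubling construction
(`CompatibleSplittingCMDoubling.gru_shape_of`) with its two analytic inputs, both theorems of the tree:
* the finite places — `nonempty_finLocalFamily` (`DoubledWeilRepresentationLocalFamilyCM`, on the per-place package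
  `LocalDoubledUnitarySplittingData*`: Kudla's local splitting of the doubled unitary group, its parabolic
  normalisation and the unramified computation);
* the archimedean places — `exists_isArchHalf` (`DoubledWeilRepresentationArchHalf`: Folland's `det^{1/2}`-normalised
  metaplectic section over `U(n,n)(ℝ)` twisted by a `det`-power character).
`gru_shape` has LITERALLY the quantifier block consumed downstream (`∀ L … e dV hdV hdV0 dW hdW hdW0,
(cmSplittingDatum …).CompatibleSplitting`), so a consumer's hypothesis binder of that type is discharged by the term
`gru_shape`.
-/

set_option autoImplicit false

noncomputable section

open NumberField
open Literature.RepresentationTheory.HarrisKudlaSweet1996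

namespace Literature.NumberTheory.GelbartRogawski1991.GRConstruction

open UnitaryDualPair

/-- **[GelbartRogawski1991, Prop. 3.1.1] at every CM dual-pair datum, unconditionally**: for every CM field `L`, every
re-indexing `e : Fin N × Fin M ≃ Fin n` and all real non-zero diagonal hermitian data `dV`, `dW`, the metaplectic cover
`Mp(𝕎)ᶜᵒⁿᵗ → Sp(𝕎)(𝔸_{L⁺})` (`𝕎 = Res_{L/L⁺}(V ⊗_L W)`) admits a continuous splitting over `U(V ⊗ W)(𝔸_{L⁺})` whose
values on rational points lie in the range of Weil's rational section `r_F` — `SplittingDatum.CompatibleSplitting` of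
`cmSplittingDatum L e dV hdV hdV0 dW hdW hdW0`. [cite: GelbartRogawski1991, §3.1 Prop. 3.1.1 p. 455 L1–2] -/
theorem gru_shape :
    ∀ (L : Type) [Field L] [NumberField L] [IsCMField L] {N M n : ℕ} (e : Fin N × Fin M ≃ Fin n)
      (dV : Fin N → L) (hdV : ∀ i, IsCMField.complexConj L (dV i) = dV i) (hdV0 : ∀ i, dV i ≠ 0)
      (dW : Fin M → L) (hdW : ∀ i, IsCMField.complexConj L (dW i) = dW i) (hdW0 : ∀ i, dW i ≠ 0),
      (cmSplittingDatum L e dV hdV hdV0 dW hdW hdW0).CompatibleSplitting :=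
  gru_shape_of
    (fun L _ _ _ _ _ _ e dV hdV hdV0 dW hdW hdW0 χ _ hχ 𝔪 =>
      nonempty_finLocalFamily L e dV hdV hdV0 dW hdW hdW0 χ hχ 𝔪)
    (fun L _ _ _ _ _ _ e dV hdV hdV0 dW hdW hdW0 χ hχu hχ =>
      exists_isArchHalf L e dV hdV hdV0 dW hdW hdW0 χ hχu hχ)

/-- the same at ONE datum (pointwise form of `gru_shape`). [cite: GelbartRogawski1991, §3.1 Prop. 3.1.1 p. 455 L1–2] -/
theorem compatibleSplitting_cmSplittingDatum (L : Type) [Field L] [NumberField L] [IsCMField L] {N M n : ℕ}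
    (e : Fin N × Fin M ≃ Fin n) (dV : Fin N → L) (hdV : ∀ i, IsCMField.complexConj L (dV i) = dV i)
    (hdV0 : ∀ i, dV i ≠ 0) (dW : Fin M → L) (hdW : ∀ i, IsCMField.complexConj L (dW i) = dW i)
    (hdW0 : ∀ i, dW i ≠ 0) : (cmSplittingDatum L e dV hdV hdV0 dW hdW hdW0).CompatibleSplitting :=
  gru_shape L e dV hdV hdV0 dW hdW hdW0

end Literature.NumberTheory.GelbartRogawski1991.GRConstruction

end
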